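import Summits.NavierStokesRegularity.NavierStokesRegularity.Theorems.OddMorawetzLocal.Negative.OddMorawetzLocalB3Reduction
import Summits.NavierStokesRegularity.NavierStokesRegularity.Theorems.OddMorawetzMorawetzKillsTypeIRotate
import Summits.NavierStokesRegularity.NavierStokesRegularity.Theorems.OddMorawetzMorawetzKillsTypeIRotateEulerBilinear
import Summits.NavierStokesRegularity.NavierStokesRegularity.Theorems.OddMorawetzMorawetzKillsTypeIWeightParity

/-!
# Crux `OddMorawetz.MorawetzKillsTypeI` (stmt-NavierStokesRegularity-1377), line `registered`:
  stub `stub_isotropicReduction` — reduction to `O(3)`-invariant Morawetz certificates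

A Morawetz certificate `(k, m)` (a smooth, pointwise cubic density `m` on 3-jets of derivative weight `k`
whose Euler derivative `Q_m(v) = -∫ Dm(Jv)[J B(v,v)]` is `≥ 0` on divergence-free Schwartz fields and `> 0`
on one of them) can be AVERAGED over the compact group `O(3)` of linear isometries of `ℝ³`: the result is an
`O(3)`-invariant certificate of the same weight. This is the hyperoctahedral averaging of
`OddMorawetzLocalB3Reduction` (48 terms) redone with Haar measure.

* The group. `O(3)` is realised as `unitary (ℝ³ →L[ℝ] ℝ³)` (Mathlib's `Unitary.linearIsometryEquiv` identifies
  it with `ℝ³ ≃ₗᵢ[ℝ] ℝ³`, so EVERY linear isometry is reached); it is compact (closed and bounded in a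
  finite-dimensional space), and we use its Haar probability measure `μ` (left invariant, positive on open sets).
* The average. A smooth pointwise-cubic `m` is the cubic form `m z = 6⁻¹ D³m(0)[z,z,z]`
  (`six_mul_eq_iteratedFDeriv_of_cubic`); the averaged density is `m̄ z = 6⁻¹ T̄[z,z,z]` with
  `T̄ = ∫ D³m(0) ∘ (ρ_{g⁻¹})^{×3} dμ(g)` a Bochner integral of continuous trilinear forms (`ρ_g = jetAct g`), so
  `m̄` is visibly smooth and cubic, while `m̄ z = ∫ m(ρ_{g⁻¹} z) dμ` gives the weight and the invariance.
* The Euler derivative of the average. `D m̄(z)[w] = ∫ D(m ∘ ρ_{g⁻¹})(z)[w] dμ`, and by Fubini (the integrand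
  `(x, g) ↦ Dm(ρ_g Jv x)[ρ_g J B(v,v) x]` is continuous and `O((1+|x|)⁻⁴)` uniformly in `g`: `ρ_g` is bounded on
  the compact group, `Dm` on compact balls of the finite-dimensional jet space, and the jets decay by
  `StubFluxTransfer.jet_bounds` / `stub_jetDecay`) and the landed covariance `morawetzQ_rotate` /
  `stub_rotate_eulerBilinear`, `Q_{m̄}(v) = ∫ Q_m(g⁻¹·v) dμ(g)`: nonnegative termwise, and positive at the strict
  witness because `g ↦ Q_m(g⁻¹·v₀)` is continuous (dominated convergence), positive at `g = 1`, and Haar measure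
  charges open sets.

Everything is proved; no definitions, no named facts. Lands `--supports stmt-NavierStokesRegularity-1377`.
-/

noncomputable section

-- the route's Theorems namespace repeats the summit name by design (Summit.<S>.<P>.Theorems, S = P)
set_option linter.dupNamespace false

namespace Summit.NavierStokesRegularity.NavierStokesRegularity.Theorems

open Summit.NavierStokesRegularity.NavierStokesRegularity.Theorems.OddMorawetz
open MeasureTheory Filter Literature.Analysis.FluidPDE

namespace IsotropicReduction

/-! ### The jet action: explicit form and continuity in the isometry -/

/-- `mlAct` written with `toContinuousLinearEquiv` coercions (the form used by `morawetzQ_rotate`). -/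
theorem mlAct_eq (R : E3 ≃ₗᵢ[ℝ] E3) (n : ℕ) (A : E3 [×n]→L[ℝ] E3) :
    mlAct R n A = (R.toContinuousLinearEquiv : E3 →L[ℝ] E3).compContinuousMultilinearMap
      (A.compContinuousLinearMap fun _ => (R.symm.toContinuousLinearEquiv : E3 →L[ℝ] E3)) :=
  ContinuousMultilinearMap.ext fun h => by simp [mlAct_apply]

/-- The density composed with the explicit jet action of `morawetzQ_rotate` is `m ∘ jetAct R`. -/
theorem comp_jetAct_eq (R : E3 ≃ₗᵢ[ℝ] E3) (m : Jet3 → ℝ) :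
    (fun z : Jet3 => m (R z.1,
        (R.toContinuousLinearEquiv : E3 →L[ℝ] E3).compContinuousMultilinearMap
          (z.2.1.compContinuousLinearMap fun _ => (R.symm.toContinuousLinearEquiv : E3 →L[ℝ] E3)),
        (R.toContinuousLinearEquiv : E3 →L[ℝ] E3).compContinuousMultilinearMap
          (z.2.2.1.compContinuousLinearMap fun _ => (R.symm.toContinuousLinearEquiv : E3 →L[ℝ] E3)),
        (R.toContinuousLinearEquiv : E3 →L[ℝ] E3).compContinuousMultilinearMap
          (z.2.2.2.compContinuousLinearMap fun _ => (R.symm.toContinuousLinearEquiv : E3 →L[ℝ] E3)))) =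
      m ∘ ⇑(jetAct R) := by
  funext z
  rw [Function.comp_apply, jetAct_apply, mlAct_eq, mlAct_eq, mlAct_eq]

/-- **Continuity of the jet action in the isometry**: if `x ↦ R x` and `x ↦ (R x)⁻¹` are continuous into the
continuous linear maps, so is `x ↦ jetAct (R x)` (operator norm). -/
theorem continuous_jetAct {X : Type*} [TopologicalSpace X] {R : X → (E3 ≃ₗᵢ[ℝ] E3)}
    (h1 : Continuous fun x => ((R x : E3 ≃ₗᵢ[ℝ] E3) : E3 →L[ℝ] E3))
    (h2 : Continuous fun x => (((R x).symm : E3 ≃ₗᵢ[ℝ] E3) : E3 →L[ℝ] E3)) :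
    Continuous fun x => (jetAct (R x) : Jet3 →L[ℝ] Jet3) := by
  have hml : ∀ n : ℕ, Continuous fun x =>
      (mlAct (R x) n : (E3 [×n]→L[ℝ] E3) →L[ℝ] (E3 [×n]→L[ℝ] E3)) := fun n =>
    ((ContinuousLinearMap.compContinuousMultilinearMapL ℝ (fun _ : Fin n => E3) E3 E3).continuous.comp
      h1).clm_comp
      ((ContinuousMultilinearMap.compContinuousLinearMapContinuousMultilinear ℝ
        (fun _ : Fin n => E3) (fun _ : Fin n => E3) E3).cont.comp (continuous_pi fun _ => h2))
  exact h1.prod_mapL ℝ ((hml 1).prod_mapL ℝ ((hml 2).prod_mapL ℝ (hml 3)))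

/-! ### Cubic forms along the diagonal -/

section Diagonal

variable {V : Type*} [NormedAddCommGroup V] [NormedSpace ℝ V]

/-- The diagonal restriction of a continuous trilinear form is smooth. -/
theorem contDiff_diag (S : V [×3]→L[ℝ] ℝ) : ContDiff ℝ (⊤ : ℕ∞) fun z : V => S fun _ => z :=
  S.contDiff.comp (contDiff_pi.mpr fun _ => contDiff_id)

/-- Derivative of the diagonal restriction of a continuous trilinear form:
`D(z ↦ S(z,z,z))(z)[w] = S(w,z,z) + S(z,w,z) + S(z,z,w)`. -/
theorem fderiv_diag (S : V [×3]→L[ℝ] ℝ) (z w : V) :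
    fderiv ℝ (fun z : V => S fun _ => z) z w = ∑ i : Fin 3, S (Function.update (fun _ => z) i w) := by
  have hL : HasFDerivAt (fun z : V => S fun _ : Fin 3 => z)
      ((S.linearDeriv fun _ => z).comp (ContinuousLinearMap.pi fun _ : Fin 3 => ContinuousLinearMap.id ℝ V)) z :=
    (S.hasFDerivAt fun _ => z).comp z (ContinuousLinearMap.pi fun _ : Fin 3 => ContinuousLinearMap.id ℝ V).hasFDerivAt
  rw [hL.fderiv]
  simp [ContinuousMultilinearMap.linearDeriv_apply]

/-- Cubic homogeneity of the diagonal restriction. -/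
theorem diag_smul (S : V [×3]→L[ℝ] ℝ) (c : ℝ) (z : V) : S (fun _ => c • z) = c ^ 3 * S fun _ => z := by
  simpa using S.map_smul_univ (fun _ => c) (fun _ => z)

/-- A smooth pointwise-cubic density, transported by a continuous linear map `ρ`, is `6⁻¹` times the diagonal
restriction of the transported trilinear form `D³m(0) ∘ ρ^{×3}` (`six_mul_eq_iteratedFDeriv_of_cubic`). -/
theorem cubic_comp_apply {m : V → ℝ} (hm : ContDiff ℝ (⊤ : ℕ∞) m) (hcub : ∀ (μ : ℝ) (z : V), m (μ • z) = μ ^ 3 * m z)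
    (ρ : V →L[ℝ] V) (z : V) :
    m (ρ z) = 6⁻¹ * ((iteratedFDeriv ℝ 3 m 0).compContinuousLinearMap fun _ => ρ) (fun _ => z) := by
  rw [ContinuousMultilinearMap.compContinuousLinearMap_apply, ← six_mul_eq_iteratedFDeriv_of_cubic hm hcub]
  ring

/-- Derivative of a smooth pointwise-cubic density transported by `ρ`, through the transported trilinear form. -/
theorem fderiv_cubic_comp {m : V → ℝ} (hm : ContDiff ℝ (⊤ : ℕ∞) m) (hcub : ∀ (μ : ℝ) (z : V), m (μ • z) = μ ^ 3 * m z)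
    (ρ : V →L[ℝ] V) (z w : V) :
    fderiv ℝ (m ∘ ⇑ρ) z w =
      6⁻¹ * fderiv ℝ (fun z : V => ((iteratedFDeriv ℝ 3 m 0).compContinuousLinearMap fun _ => ρ) fun _ => z) z w := by
  have h : m ∘ ⇑ρ = fun z => 6⁻¹ * ((iteratedFDeriv ℝ 3 m 0).compContinuousLinearMap fun _ => ρ) (fun _ => z) :=
    funext fun z => cubic_comp_apply hm hcub ρ z
  rw [h, fderiv_const_mul (((contDiff_diag _).differentiable (by simp)) z)]
  rfl

end Diagonal

/-! ### Averages over a compact space -/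

section Average

variable {G : Type*} [TopologicalSpace G] [CompactSpace G] [MeasurableSpace G] [OpensMeasurableSpace G]
  (μ : Measure G) [IsFiniteMeasure μ]

/-- Continuous functions on a compact space are integrable for a finite measure. -/
theorem integrable_of_continuous {β : Type*} [NormedAddCommGroup β] {f : G → β} (hf : Continuous f) :
    Integrable f μ :=
  hf.integrable_of_hasCompactSupport (HasCompactSupport.of_compactSpace f)

variable {V : Type*} [NormedAddCommGroup V] [NormedSpace ℝ V]

/-- Evaluation commutes with the Bochner average of continuous trilinear forms. -/
theorem avg_apply {Φ : G → V [×3]→L[ℝ] ℝ} (hΦ : Continuous Φ) (x : Fin 3 → V) :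
    (∫ g, Φ g ∂μ) x = ∫ g, Φ g x ∂μ :=
  ContinuousMultilinearMap.integral_apply (integrable_of_continuous μ hΦ) x

/-- The derivative of the diagonal restriction of an averaged trilinear form is the average of the
derivatives. -/
theorem fderiv_avg_diag {Φ : G → V [×3]→L[ℝ] ℝ} (hΦ : Continuous Φ) (z w : V) :
    fderiv ℝ (fun z : V => (∫ g, Φ g ∂μ) fun _ => z) z w = ∫ g, fderiv ℝ (fun z : V => Φ g fun _ => z) z w ∂μ := by
  simp_rw [fderiv_diag, avg_apply μ hΦ]
  rw [integral_finsetSum]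
  exact fun i _ => integrable_of_continuous μ ((continuous_eval_const _).comp hΦ)

/-- A continuous nonnegative function on a compact space, positive somewhere, has positive integral for a
finite measure charging open sets. -/
theorem integral_pos_of_continuous [μ.IsOpenPosMeasure] {φ : G → ℝ} (hφ : Continuous φ) (h0 : ∀ g, 0 ≤ φ g)
    {g₀ : G} (hg₀ : 0 < φ g₀) : 0 < ∫ g, φ g ∂μ := by
  rw [integral_pos_iff_support_of_nonneg (fun g => h0 g) (integrable_of_continuous μ hφ)]
  exact (IsOpen.measure_pos μ (isOpen_lt continuous_const hφ) ⟨g₀, hg₀⟩).trans_le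
    (measure_mono fun g hg => ne_of_gt hg)

end Average

/-! ### The Euler-derivative integrand, uniformly in the group variable -/

/-- **Uniform domination.** For a continuous family `ρ_g` of jet transformations over a compact space, a `C¹`
density `m`, and continuous jet fields `jv`, `jb` decaying like `(1+|x|)⁻⁴`, the integrand
`(x, g) ↦ Dm(ρ_g jv x)[ρ_g jb x]` is continuous and `O((1+|x|)⁻⁴)` uniformly in `g` (`ρ_g` is bounded on the
compact space; `Dm` is bounded on the compact ball of the finite-dimensional jet space containing all
`ρ_g jv x`). -/
theorem pairing_bound {X : Type*} [TopologicalSpace X] [CompactSpace X] {ρ : X → (Jet3 →L[ℝ] Jet3)}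
    (hρ : Continuous ρ) {m : Jet3 → ℝ} (hm : ContDiff ℝ 1 m) {jv jb : E3 → Jet3} {Kv Kb : ℝ}
    (hjv : Continuous jv) (hjb : Continuous jb) (hv0 : ∀ x, ‖jv x‖ ≤ Kv * ((1 + ‖x‖) ^ 4)⁻¹)
    (hb0 : ∀ x, ‖jb x‖ ≤ Kb * ((1 + ‖x‖) ^ 4)⁻¹) :
    (Continuous fun p : E3 × X => fderiv ℝ m (ρ p.2 (jv p.1)) (ρ p.2 (jb p.1))) ∧
      ∃ C : ℝ, ∀ (x : E3) (g : X), ‖fderiv ℝ m (ρ g (jv x)) (ρ g (jb x))‖ ≤ C * ((1 + ‖x‖) ^ 4)⁻¹ := by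
  haveI := StubFluxTransfer.finiteDimensional_continuousMultilinearMap 1
  haveI := StubFluxTransfer.finiteDimensional_continuousMultilinearMap 2
  haveI := StubFluxTransfer.finiteDimensional_continuousMultilinearMap 3
  have hρ1 : Continuous fun p : E3 × X => ρ p.2 (jv p.1) :=
    (hρ.comp continuous_snd).clm_apply (hjv.comp continuous_fst)
  have hρ2 : Continuous fun p : E3 × X => ρ p.2 (jb p.1) :=
    (hρ.comp continuous_snd).clm_apply (hjb.comp continuous_fst)
  refine ⟨((hm.continuous_fderiv one_ne_zero).comp hρ1).clm_apply hρ2, ?_⟩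
  obtain ⟨Cρ, hCρ⟩ := isCompact_univ.exists_bound_of_continuousOn (f := ρ) hρ.continuousOn
  have hCρ' : ∀ g, ‖ρ g‖ ≤ Cρ := fun g => hCρ g (Set.mem_univ g)
  obtain ⟨M, hM⟩ := (isCompact_closedBall (0 : Jet3) (Cρ * Kv)).exists_bound_of_continuousOn
    (hm.continuous_fderiv one_ne_zero).continuousOn
  refine ⟨M * (Cρ * Kb), fun x g => ?_⟩
  have hg0 : 0 ≤ Cρ := le_trans (norm_nonneg (ρ g)) (hCρ' g)
  have hmem : ρ g (jv x) ∈ Metric.closedBall (0 : Jet3) (Cρ * Kv) := by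
    rw [Metric.mem_closedBall, dist_zero_right]
    exact (ContinuousLinearMap.le_opNorm _ _).trans
      (mul_le_mul (hCρ' g) ((StubFluxTransfer.nonneg_of_decay hv0).2 x) (norm_nonneg _) hg0)
  have hM0 : 0 ≤ M := (norm_nonneg _).trans (hM _ hmem)
  calc ‖fderiv ℝ m (ρ g (jv x)) (ρ g (jb x))‖ ≤ ‖fderiv ℝ m (ρ g (jv x))‖ * ‖ρ g (jb x)‖ :=
        ContinuousLinearMap.le_opNorm _ _
    _ ≤ M * (Cρ * (Kb * ((1 + ‖x‖) ^ 4)⁻¹)) :=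
        mul_le_mul (hM _ hmem) ((ContinuousLinearMap.le_opNorm _ _).trans
          (mul_le_mul (hCρ' g) (hb0 x) (norm_nonneg _) hg0)) (norm_nonneg _) hM0
    _ = M * (Cρ * Kb) * ((1 + ‖x‖) ^ 4)⁻¹ := by ring

/-- **Fubini and continuity for a dominated continuous integrand**: if `F : ℝ³ × G → ℝ` is continuous and
`|F(x, g)| ≤ C (1+|x|)⁻⁴`, then `∫ₓ ∫_g F = ∫_g ∫ₓ F` for every finite Borel measure on `G`, and `g ↦ ∫ₓ F(x,g)`
is continuous (dominated convergence; `(1+|x|)⁻⁴` is integrable on `ℝ³`). -/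
theorem pairing_swap {G : Type*} [TopologicalSpace G] [FirstCountableTopology G] [MeasurableSpace G]
    [OpensMeasurableSpace G] (μ : Measure G) [IsFiniteMeasure μ] {F : E3 → G → ℝ}
    (hF : Continuous (Function.uncurry F)) {C : ℝ} (hC : ∀ x g, ‖F x g‖ ≤ C * ((1 + ‖x‖) ^ 4)⁻¹) :
    (∫ x, ∫ g, F x g ∂μ = ∫ g, (∫ x, F x g) ∂μ) ∧ Continuous fun g => ∫ x, F x g := by
  have hbound : Integrable fun x : E3 => C * ((1 + ‖x‖) ^ 4)⁻¹ :=
    StubFluxTransfer.integrable_inv_one_add_norm_pow.const_mul C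
  refine ⟨integral_integral_swap ((hbound.comp_fst μ).mono' hF.aestronglyMeasurable
    (ae_of_all _ fun p => hC p.1 p.2)), ?_⟩
  exact continuous_of_dominated (fun g => (hF.comp (continuous_id.prodMk continuous_const)).aestronglyMeasurable)
    (fun g => ae_of_all _ fun x => hC x g) hbound
    (ae_of_all _ fun x => hF.comp (continuous_const.prodMk continuous_id))

/-! ### The averaged density and its Euler derivative -/

/-- **The average of a cubic form over a compact family of linear maps.** For a continuous family `ρ_g` of
continuous linear maps over a compact space with a finite measure and a smooth pointwise-cubic `m`, the density
`m̄ z := 6⁻¹ T̄(z,z,z)`, `T̄ := ∫ D³m(0) ∘ ρ_g^{×3} dμ(g)` (a Bochner integral of trilinear forms), is smooth and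
cubic, `m̄ z = ∫ m(ρ_g z) dμ`, and `Dm̄(z)[w] = ∫ D(m ∘ ρ_g)(z)[w] dμ`. -/
theorem exists_average {G : Type*} [TopologicalSpace G] [CompactSpace G] [MeasurableSpace G]
    [OpensMeasurableSpace G] (μ : Measure G) [IsFiniteMeasure μ] {V : Type*} [NormedAddCommGroup V]
    [NormedSpace ℝ V] {ρ : G → (V →L[ℝ] V)} (hρ : Continuous ρ) {m : V → ℝ} (hm : ContDiff ℝ (⊤ : ℕ∞) m)
    (hcub : ∀ (c : ℝ) (z : V), m (c • z) = c ^ 3 * m z) :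
    ∃ m' : V → ℝ, ContDiff ℝ (⊤ : ℕ∞) m' ∧ (∀ (c : ℝ) (z : V), m' (c • z) = c ^ 3 * m' z) ∧
      (∀ z, m' z = ∫ g, m (ρ g z) ∂μ) ∧ ∀ z w, fderiv ℝ m' z w = ∫ g, fderiv ℝ (m ∘ ⇑(ρ g)) z w ∂μ := by
  set Φ : G → V [×3]→L[ℝ] ℝ := fun g => (iteratedFDeriv ℝ 3 m 0).compContinuousLinearMap fun _ => ρ g
    with hΦ
  have hΦc : Continuous Φ :=
    ((ContinuousMultilinearMap.compContinuousLinearMapContinuousMultilinear ℝ (fun _ : Fin 3 => V)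
      (fun _ : Fin 3 => V) ℝ).cont.comp (continuous_pi fun _ => hρ)).clm_apply continuous_const
  refine ⟨fun z => 6⁻¹ * (∫ g, Φ g ∂μ) fun _ => z, contDiff_const.mul (contDiff_diag _), fun c z => ?_,
    fun z => ?_, fun z w => ?_⟩
  · show 6⁻¹ * (∫ g, Φ g ∂μ) (fun _ => c • z) = c ^ 3 * (6⁻¹ * (∫ g, Φ g ∂μ) fun _ => z)
    rw [diag_smul]
    ring
  · show 6⁻¹ * (∫ g, Φ g ∂μ) (fun _ => z) = _
    rw [avg_apply μ hΦc, ← integral_const_mul]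
    refine integral_congr_ae (ae_of_all _ fun g => ?_)
    simp only [hΦ]
    rw [cubic_comp_apply hm hcub]
  · rw [fderiv_const_mul (((contDiff_diag _).differentiable (by simp)) z)]
    show 6⁻¹ * fderiv ℝ (fun z : V => (∫ g, Φ g ∂μ) fun _ => z) z w = _
    rw [fderiv_avg_diag μ hΦc, ← integral_const_mul]
    refine integral_congr_ae (ae_of_all _ fun g => ?_)
    simp only [hΦ]
    rw [fderiv_cubic_comp hm hcub]

/-- **Isometry covariance of the Euler derivative, in terms of the jet action** (the landed `morawetzQ_rotate`
fed with `stub_rotate_eulerBilinear`, the composed density identified as `m ∘ jetAct R`, and the chain rule):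
`Q_m(R·v) = -∫ Dm(ρ_R Jv x)[ρ_R J B(v,v) x] dx`. -/
theorem morawetzQ_jetAct {m : Jet3 → ℝ} (hm : ContDiff ℝ (⊤ : ℕ∞) m) (R : E3 ≃ₗᵢ[ℝ] E3) (v : E3 → E3) :
    (-∫ x, fderiv ℝ m ((rotateField R v x, iteratedFDeriv ℝ 1 (rotateField R v) x,
        iteratedFDeriv ℝ 2 (rotateField R v) x, iteratedFDeriv ℝ 3 (rotateField R v) x) : Jet3)
        ((eulerBilinear (rotateField R v) (rotateField R v) x,
          iteratedFDeriv ℝ 1 (eulerBilinear (rotateField R v) (rotateField R v)) x,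
          iteratedFDeriv ℝ 2 (eulerBilinear (rotateField R v) (rotateField R v)) x,
          iteratedFDeriv ℝ 3 (eulerBilinear (rotateField R v) (rotateField R v)) x) : Jet3)) =
      -∫ x, fderiv ℝ m (jetAct R ((v x, iteratedFDeriv ℝ 1 v x, iteratedFDeriv ℝ 2 v x, iteratedFDeriv ℝ 3 v x) : Jet3))
        (jetAct R ((eulerBilinear v v x, iteratedFDeriv ℝ 1 (eulerBilinear v v) x,
          iteratedFDeriv ℝ 2 (eulerBilinear v v) x, iteratedFDeriv ℝ 3 (eulerBilinear v v) x) : Jet3)) := by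
  have h := morawetzQ_rotate stub_rotate_eulerBilinear hm R v
  rw [comp_jetAct_eq R m] at h
  simp only [fderiv_comp_jetAct (hm.differentiable (by simp))] at h
  exact h

/-- **The Euler derivative of an averaged density is the average of the Euler derivatives of the rotated
fields**, continuously in the group variable. If `Dm'(z)[w] = ∫ D(m ∘ ρ_{S g})(z)[w] dμ(g)` for a continuous
family of isometries `S g` over a compact space, then for a divergence-free Schwartz `v`,
`Q_{m'}(v) = ∫ Q_m(S g · v) dμ(g)` (Fubini, `pairing_bound` / `pairing_swap`, and `morawetzQ_jetAct`), and
`g ↦ Q_m(S g · v)` is continuous (dominated convergence). -/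
theorem morawetzQ_average {G : Type*} [TopologicalSpace G] [CompactSpace G] [FirstCountableTopology G]
    [MeasurableSpace G] [OpensMeasurableSpace G] (μ : Measure G) [IsFiniteMeasure μ]
    {S : G → (E3 ≃ₗᵢ[ℝ] E3)} (hρ : Continuous fun g => (jetAct (S g) : Jet3 →L[ℝ] Jet3))
    {m m' : Jet3 → ℝ} (hm : ContDiff ℝ (⊤ : ℕ∞) m)
    (hder : ∀ z w, fderiv ℝ m' z w = ∫ g, fderiv ℝ (m ∘ ⇑(jetAct (S g))) z w ∂μ)
    {v : E3 → E3} (hv : IsSchwartzField v) (hd : VectorCalculus.IsDivFree v) :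
    (-∫ x, fderiv ℝ m' ((v x, iteratedFDeriv ℝ 1 v x, iteratedFDeriv ℝ 2 v x, iteratedFDeriv ℝ 3 v x) : Jet3)
        ((eulerBilinear v v x, iteratedFDeriv ℝ 1 (eulerBilinear v v) x, iteratedFDeriv ℝ 2 (eulerBilinear v v) x,
          iteratedFDeriv ℝ 3 (eulerBilinear v v) x) : Jet3)) =
      ∫ g, (-∫ x, fderiv ℝ m ((rotateField (S g) v x, iteratedFDeriv ℝ 1 (rotateField (S g) v) x,
          iteratedFDeriv ℝ 2 (rotateField (S g) v) x, iteratedFDeriv ℝ 3 (rotateField (S g) v) x) : Jet3)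
        ((eulerBilinear (rotateField (S g) v) (rotateField (S g) v) x,
          iteratedFDeriv ℝ 1 (eulerBilinear (rotateField (S g) v) (rotateField (S g) v)) x,
          iteratedFDeriv ℝ 2 (eulerBilinear (rotateField (S g) v) (rotateField (S g) v)) x,
          iteratedFDeriv ℝ 3 (eulerBilinear (rotateField (S g) v) (rotateField (S g) v)) x) : Jet3)) ∂μ ∧
    Continuous fun g => -∫ x, fderiv ℝ m ((rotateField (S g) v x, iteratedFDeriv ℝ 1 (rotateField (S g) v) x,
          iteratedFDeriv ℝ 2 (rotateField (S g) v) x, iteratedFDeriv ℝ 3 (rotateField (S g) v) x) : Jet3)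
        ((eulerBilinear (rotateField (S g) v) (rotateField (S g) v) x,
          iteratedFDeriv ℝ 1 (eulerBilinear (rotateField (S g) v) (rotateField (S g) v)) x,
          iteratedFDeriv ℝ 2 (eulerBilinear (rotateField (S g) v) (rotateField (S g) v)) x,
          iteratedFDeriv ℝ 3 (eulerBilinear (rotateField (S g) v) (rotateField (S g) v)) x) : Jet3) := by
  have hmd : Differentiable ℝ m := hm.differentiable (by simp)
  obtain ⟨A, hA⟩ := schwartz_decay_four hv
  obtain ⟨hb, C, hC⟩ := stub_jetDecay v hv hd
  obtain ⟨hJv, hJv0, -⟩ := StubFluxTransfer.jet_bounds ((isSchwartzField_iff v).1 hv).1 hA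
  obtain ⟨hJb, hJb0, -⟩ := StubFluxTransfer.jet_bounds hb hC
  obtain ⟨hFc, K, hK⟩ := pairing_bound hρ (hm.of_le (by simp)) hJv.continuous hJb.continuous hJv0 hJb0
  obtain ⟨hswap, hcont⟩ := pairing_swap μ
    (F := fun x g => fderiv ℝ m (jetAct (S g) ((v x, iteratedFDeriv ℝ 1 v x, iteratedFDeriv ℝ 2 v x,
        iteratedFDeriv ℝ 3 v x) : Jet3))
      (jetAct (S g) ((eulerBilinear v v x, iteratedFDeriv ℝ 1 (eulerBilinear v v) x,
        iteratedFDeriv ℝ 2 (eulerBilinear v v) x, iteratedFDeriv ℝ 3 (eulerBilinear v v) x) : Jet3))) hFc hK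
  refine ⟨?_, hcont.neg.congr fun g => (morawetzQ_jetAct hm (S g) v).symm⟩
  refine Eq.trans ?_ (integral_congr_ae (ae_of_all _ fun g => (morawetzQ_jetAct hm (S g) v).symm))
  rw [integral_neg, ← hswap]
  congr 1
  refine integral_congr_ae (ae_of_all _ fun x => ?_)
  beta_reduce
  rw [hder]
  exact integral_congr_ae (ae_of_all _ fun g => fderiv_comp_jetAct hmd _ _ _)

end IsotropicReduction

/-! ### The reduction -/

/-- **stub `stub_isotropicReduction`: reduction to `O(3)`-invariant Morawetz certificates.** A Morawetz
certificate `(k, m)` (smooth, pointwise cubic, derivative weight `k`, `Q_m ≥ 0` on divergence-free Schwartz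
fields and `> 0` once — the crux's clauses with its own `let J` / `let Q`) yields an `O(3)`-INVARIANT certificate
`(k, m̄)`: `m̄ (jetAct g z) = m̄ z` for every linear isometry `g` of `ℝ³`. Construction: Haar average over the
compact group `unitary (ℝ³ →L[ℝ] ℝ³) ≃* (ℝ³ ≃ₗᵢ[ℝ] ℝ³)` of the trilinear form `D³m(0)` transported by `jetAct`
(`exists_average`); `Q_{m̄}(v) = ∫ Q_m(g⁻¹·v) dμ(g)` (`morawetzQ_average`), `≥ 0` termwise, `> 0` at the strict
witness by continuity in `g` and positivity of Haar measure on open sets. -/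
theorem stub_isotropicReduction :
    ∀ (k : ℕ) (m : Jet3 → ℝ),
      let J := fun (v : E3 → E3) (x : E3) => ((v x, iteratedFDeriv ℝ 1 v x, iteratedFDeriv ℝ 2 v x, iteratedFDeriv ℝ 3 v x) : Jet3);
      let Q := fun (m : Jet3 → ℝ) (v : E3 → E3) =>
        -∫ x, fderiv ℝ m (J v x) (J (Literature.Analysis.FluidPDE.eulerBilinear v v) x);
      ContDiff ℝ (⊤ : ℕ∞) m → (∀ (μ : ℝ) z, m (μ • z) = μ ^ 3 * m z) →
      (∀ (s : ℝ), 0 < s → ∀ (z₀ : E3) (z₁ : E3 [×1]→L[ℝ] E3) (z₂ : E3 [×2]→L[ℝ] E3) (z₃ : E3 [×3]→L[ℝ] E3),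
          m (z₀, s • z₁, (s ^ 2) • z₂, (s ^ 3) • z₃) = s ^ k * m (z₀, z₁, z₂, z₃)) →
      (∀ v, Literature.Analysis.FluidPDE.IsSchwartzField v →
          Literature.Analysis.FluidPDE.VectorCalculus.IsDivFree v → 0 ≤ Q m v) →
      (∃ v, Literature.Analysis.FluidPDE.IsSchwartzField v ∧
          Literature.Analysis.FluidPDE.VectorCalculus.IsDivFree v ∧ 0 < Q m v) →
      ∃ m' : Jet3 → ℝ, ContDiff ℝ (⊤ : ℕ∞) m' ∧ (∀ (μ : ℝ) z, m' (μ • z) = μ ^ 3 * m' z) ∧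
        (∀ (s : ℝ), 0 < s → ∀ (z₀ : E3) (z₁ : E3 [×1]→L[ℝ] E3) (z₂ : E3 [×2]→L[ℝ] E3) (z₃ : E3 [×3]→L[ℝ] E3),
          m' (z₀, s • z₁, (s ^ 2) • z₂, (s ^ 3) • z₃) = s ^ k * m' (z₀, z₁, z₂, z₃)) ∧
        (∀ (g : E3 ≃ₗᵢ[ℝ] E3) (z : Jet3), m' (jetAct g z) = m' z) ∧
        (∀ v, Literature.Analysis.FluidPDE.IsSchwartzField v →
          Literature.Analysis.FluidPDE.VectorCalculus.IsDivFree v → 0 ≤ Q m' v) ∧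
        (∃ v, Literature.Analysis.FluidPDE.IsSchwartzField v ∧
          Literature.Analysis.FluidPDE.VectorCalculus.IsDivFree v ∧ 0 < Q m' v) := by
  intro k m J Q hm hcub hwt hQ hpos
  obtain ⟨v₀, hv₀, hd₀, hpos₀⟩ := hpos
  /- 1. The compact group `O(3) = unitary (E3 →L[ℝ] E3)` and its Haar probability measure. -/
  haveI : ContinuousStar (E3 →L[ℝ] E3) := ⟨ContinuousLinearMap.adjoint.continuous⟩
  haveI : CompactSpace (unitary (E3 →L[ℝ] E3)) := by
    refine isCompact_iff_compactSpace.mp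
      ((isCompact_closedBall (0 : E3 →L[ℝ] E3) 1).of_isClosed_subset isClosed_unitary fun u hu => ?_)
    rw [Metric.mem_closedBall, dist_zero_right]
    exact ContinuousLinearMap.opNorm_le_bound _ zero_le_one fun x => by
      rw [one_mul, u.norm_map_of_mem_unitary hu x]
  set μ : Measure (unitary (E3 →L[ℝ] E3)) := Measure.haarMeasure ⊤ with hμ
  haveI : IsProbabilityMeasure μ :=
    ⟨by rw [hμ, ← TopologicalSpace.PositiveCompacts.coe_top]; exact Measure.haarMeasure_self⟩
  haveI : μ.IsMulLeftInvariant := by rw [hμ]; infer_instance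
  haveI : μ.IsOpenPosMeasure := by rw [hμ]; infer_instance
  /- 2. All linear isometries, continuously parametrised by the group (`Unitary.linearIsometryEquiv`). -/
  set R : unitary (E3 →L[ℝ] E3) →* (E3 ≃ₗᵢ[ℝ] E3) := Unitary.linearIsometryEquiv.toMonoidHom
  have hRsurj : Function.Surjective R := Unitary.linearIsometryEquiv.surjective
  have hρc : Continuous fun g : unitary (E3 →L[ℝ] E3) => (jetAct (R g⁻¹) : Jet3 →L[ℝ] Jet3) := by
    refine IsotropicReduction.continuous_jetAct
      ((continuous_subtype_val.comp continuous_inv).congr fun g => ?_)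
      ((continuous_subtype_val.comp (continuous_star.comp continuous_inv)).congr fun g => ?_) <;>
      ext x <;> rfl
  /- 3. The averaged density and its Euler derivative. -/
  obtain ⟨m', hm's, hm'c, hint, hder⟩ := IsotropicReduction.exists_average μ hρc hm hcub
  have hQavg : ∀ v, IsSchwartzField v → VectorCalculus.IsDivFree v →
      Q m' v = ∫ g, Q m (rotateField (R g⁻¹) v) ∂μ ∧ Continuous fun g => Q m (rotateField (R g⁻¹) v) :=
    fun v hv hd => IsotropicReduction.morawetzQ_average μ hρc hm hder hv hd
  have hterm : ∀ {v : E3 → E3}, IsSchwartzField v → VectorCalculus.IsDivFree v →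
      ∀ g : unitary (E3 →L[ℝ] E3), 0 ≤ Q m (rotateField (R g⁻¹) v) := fun hv hd g =>
    hQ _ (isSchwartzField_rotateField hv _)
      (isDivFree_rotateField (((isSchwartzField_iff _).1 hv).1.differentiable (by simp)) hd _)
  /- 4. Assembly. -/
  refine ⟨m', hm's, hm'c, fun s hs z₀ z₁ z₂ z₃ => ?_, fun g z => ?_, fun v hv hd => ?_, v₀, hv₀, hd₀, ?_⟩
  · rw [hint, hint, ← integral_const_mul]
    refine integral_congr_ae (ae_of_all _ fun g => ?_)
    simp only [jetAct_apply, map_smul, hwt s hs]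
  · obtain ⟨h₀, rfl⟩ := hRsurj g
    rw [hint, hint]
    have e : (fun g => m (jetAct (R g⁻¹) (jetAct (R h₀) z))) =
        fun g => (fun g' => m (jetAct (R g'⁻¹) z)) (h₀⁻¹ * g) := by
      funext g
      simp only [jetAct_jetAct, mul_inv_rev, inv_inv, map_mul, LinearIsometryEquiv.mul_def]
    rw [e]
    exact integral_mul_left_eq_self (fun g' => m (jetAct (R g'⁻¹) z)) h₀⁻¹
  · rw [(hQavg v hv hd).1]
    exact integral_nonneg fun g => hterm hv hd g
  · rw [(hQavg v₀ hv₀ hd₀).1]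
    refine IsotropicReduction.integral_pos_of_continuous μ (hQavg v₀ hv₀ hd₀).2 (hterm hv₀ hd₀) (g₀ := 1) ?_
    simpa only [inv_one, map_one, LinearIsometryEquiv.one_def, rotateField_refl] using hpos₀

end Summit.NavierStokesRegularity.NavierStokesRegularity.Theorems

end
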